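import Mathlib.NumberTheory.Padics.Complex
import Mathlib.FieldTheory.IntermediateField.Adjoin.Basic
import Mathlib.FieldTheory.IntermediateField.Algebraic
import Mathlib.FieldTheory.Minpoly.Finite
import Mathlib.Analysis.Normed.Unbundled.SpectralNorm
import Mathlib.Analysis.SpecialFunctions.Pow.Real
import HarnessLib

/-!
# Finiteness of the norm values on a finitely generated subextension of `ℚ̄_p / ℚ_p`

Helper for Ribet's non-split-lattice lemma run directly over the (non-discretely valued) ring
`ℤ̄_p = 𝒪(ℚ̄_p)` (`PadicAlgCl p = AlgebraicClosure ℚ_[p]` with Mathlib's spectral norm): the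
lattice-improvement iteration is carried out inside `E = ℚ_p(S)` for a finite set `S` of matrix
entries, and it terminates because the absolute value takes only finitely many values on `E` in
every interval `[c, 1]`, `c > 0`.  That finiteness statement is `stub_finiteNormValues` below.

Proof: `E` is finite-dimensional over `ℚ_[p]`, say of dimension `N`; for `y ∈ E`, `y ≠ 0`, with
minimal polynomial of degree `d ∈ [1, N]` and constant coefficient `a₀ ∈ ℚ_[p]ˣ` one has
`‖y‖ ^ d = ‖a₀‖ = p ^ w` with `w ∈ ℤ` (spectral norm formula), and `c ≤ ‖y‖ ≤ 1` confines `w` to a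
finite interval; a nonnegative real is determined by its `d`-th power.

Lead `prover-line-stmt-Langlands-13639-c2-0`, line `sector-klingen-split`, crux
`ResiduallyYoshidaLifting` (stmt-Langlands-13639).
-/

noncomputable section

-- `Summit.Langlands.Langlands.…` (summit = sub-problem name, D-0017 layout) trips `dupNamespace` on every decl
set_option linter.dupNamespace false
set_option autoImplicit false

namespace Summit.Langlands.Langlands.Cruxes.ResiduallyYoshidaLifting.SectorKlingenSplit

/-- For `y` in the algebraic closure of `ℚ_[p]`, non-zero, the `d`-th power of `‖y‖`
(`d` = degree of the minimal polynomial of `y` over `ℚ_[p]`) is an integral power of `p`. [folklore] -/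
theorem norm_pow_natDegree_minpoly_eq_zpow (p : ℕ) [Fact p.Prime] {y : PadicAlgCl p} (hy : y ≠ 0) :
    ∃ w : ℤ, ‖y‖ ^ (minpoly ℚ_[p] y).natDegree = (p : ℝ) ^ w := by
  have hint : IsIntegral ℚ_[p] y := Algebra.IsIntegral.isIntegral y
  have hd : (minpoly ℚ_[p] y).natDegree ≠ 0 := (minpoly.natDegree_pos hint).ne'
  have ha₀ : (minpoly ℚ_[p] y).coeff 0 ≠ 0 := minpoly.coeff_zero_ne_zero hint hy
  refine ⟨-((minpoly ℚ_[p] y).coeff 0).valuation, ?_⟩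
  rw [← Padic.norm_eq_zpow_neg_valuation ha₀, ← PadicAlgCl.spectralNorm_eq,
    spectralNorm.spectralNorm_eq_norm_coeff_zero_rpow, one_div,
    Real.rpow_inv_natCast_pow (norm_nonneg _) hd]

/-- On a finitely generated subextension `ℚ_p(S)` of `ℚ̄_p / ℚ_p` (`S` finite) the absolute value
takes only finitely many values in every interval `[c, 1]`, `c > 0`. [folklore] -/
theorem stub_finiteNormValues :
    ∀ (p : ℕ) [Fact p.Prime] (S : Set (PadicAlgCl p)), S.Finite → ∀ c : ℝ, 0 < c →
      Set.Finite {x : ℝ | c ≤ x ∧ x ≤ 1 ∧ ∃ y ∈ IntermediateField.adjoin ℚ_[p] S, ‖(y : PadicAlgCl p)‖ = x} := by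
  intro p hp S hS c hc
  haveI : Finite S := hS.to_subtype
  haveI : FiniteDimensional ℚ_[p] (IntermediateField.adjoin ℚ_[p] S) :=
    IntermediateField.finiteDimensional_adjoin fun x _ => Algebra.IsIntegral.isIntegral x
  set N := Module.finrank ℚ_[p] (IntermediateField.adjoin ℚ_[p] S)
  have hp1 : (1 : ℝ) < p := by exact_mod_cast hp.out.one_lt
  obtain ⟨n, hn⟩ : ∃ n : ℕ, ((p : ℝ)⁻¹) ^ n < c ^ N :=
    exists_pow_lt_of_lt_one (pow_pos hc N) (inv_lt_one_of_one_lt₀ hp1)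
  refine Set.Finite.subset (s := ⋃ d ∈ Set.Icc 1 N, ⋃ w ∈ Set.Icc (-(n : ℤ)) 0,
    {x : ℝ | 0 ≤ x ∧ x ^ d = (p : ℝ) ^ w}) ?_ ?_
  · refine (Set.finite_Icc 1 N).biUnion fun d hd => (Set.finite_Icc _ _).biUnion fun w _ => ?_
    refine Set.Subsingleton.finite ?_
    rintro a ⟨ha0, ha⟩ b ⟨hb0, hb⟩
    have hd0 : d ≠ 0 := by have := hd.1; omega
    exact (pow_left_inj₀ ha0 hb0 hd0).mp (ha.trans hb.symm)
  · rintro x ⟨hcx, hx1, y, hy, rfl⟩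
    have hy0 : y ≠ 0 := by
      rintro rfl
      rw [norm_zero] at hcx
      exact absurd hcx (not_le.mpr hc)
    have hint : IsIntegral ℚ_[p] y := Algebra.IsIntegral.isIntegral y
    obtain ⟨w, hw⟩ := norm_pow_natDegree_minpoly_eq_zpow p hy0
    have hd_pos : 0 < (minpoly ℚ_[p] y).natDegree := minpoly.natDegree_pos hint
    have hd_le : (minpoly ℚ_[p] y).natDegree ≤ N := by
      have h := minpoly.natDegree_le (A := ℚ_[p]) (⟨y, hy⟩ : IntermediateField.adjoin ℚ_[p] S)
      rwa [IntermediateField.minpoly_eq] at h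
    refine Set.mem_iUnion₂.mpr ⟨(minpoly ℚ_[p] y).natDegree, ⟨hd_pos, hd_le⟩,
      Set.mem_iUnion₂.mpr ⟨w, ⟨?_, ?_⟩, norm_nonneg _, hw⟩⟩
    · -- lower bound: `p ^ (-n) < c ^ N ≤ c ^ d ≤ ‖y‖ ^ d = p ^ w`
      have hc1 : c ≤ 1 := hcx.trans hx1
      have h1 : c ^ N ≤ c ^ (minpoly ℚ_[p] y).natDegree := pow_le_pow_of_le_one hc.le hc1 hd_le
      have h2 : c ^ (minpoly ℚ_[p] y).natDegree ≤ ‖y‖ ^ (minpoly ℚ_[p] y).natDegree :=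
        pow_le_pow_left₀ hc.le hcx _
      have h3 : (p : ℝ) ^ (-(n : ℤ)) < (p : ℝ) ^ w := by
        rw [zpow_neg, zpow_natCast, ← inv_pow, ← hw]
        exact hn.trans_le (h1.trans h2)
      exact ((zpow_lt_zpow_iff_right₀ hp1).mp h3).le
    · -- upper bound: `p ^ w = ‖y‖ ^ d ≤ 1`
      have h1 : (p : ℝ) ^ w ≤ 1 := by
        rw [← hw]
        exact pow_le_one₀ (norm_nonneg _) hx1
      exact (zpow_le_one_iff_right₀ hp1).mp h1

end Summit.Langlands.Langlands.Cruxes.ResiduallyYoshidaLifting.SectorKlingenSplit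

end
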